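import Summits.CriticalPhenomena.CardyFormulaZ2.Theorems.CardyComplexConeParafermionToSLESixFamiliesDiamondIdentifyMesh
import HarnessLib

/-!
# Line `potential-darboux-picard-diamond`, conjunct (b′) of S3: interior vertices and cells of a diamond family

Helper file of the conditional stub of S3 (b′) `ClosedClass` of crux `ParafermionToSLESixFamilies`
(stmt-CriticalPhenomena-11389), line `potential-darboux-picard-diamond`. Lattice bookkeeping for the class structure of
potential limits: along an admissible family `Λ` of a marked diamond `D` and for a compact `K ⊆ D.carrier`, for all small
`δ` every lattice vertex `v` whose mesh point is within `δ` of `K` is an INTERIOR vertex of the datum `Λ δ` — off both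
discrete arcs, with all its faces inner faces and cells (`eventually_interior_vertex`, from `interior_of_block` and the
landed `eventually_mem_meshDomain_of_isMarkedDiamond` / `isCell_of_block` bookkeeping). Consequences: eventually every
face with centre in `K` is a cell (`eventually_isCell_of_ctr_mem`), so that the convergence clause of `IsPotentialLimit`
applies to all faces over `K`; and at such vertices an exact pair `(Φ, Ψ)` has the three increments
`Ψ(v) = Φ v − E(v,v)`, `Ψ(v − e₀) = Φ v − i E(v, v − e₀)`, `Ψ(v − e₁) = Φ v + i E(v, v − e₁)` (`exactPair_faces`).
-/

noncomputable section

namespace Summit.CriticalPhenomena.CardyFormulaZ2.Cruxes.ParafermionToSLESixFamilies.PotentialDarbouxPicardDiamond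

open scoped Topology
open Filter Set Metric Complex
open Literature.Probability Literature.Probability.LatticeModels Literature.Probability.Percolation
open Literature.Probability.LatticeModels.DiscreteDobrushin
open Literature.Probability.RandomPlanarGeometry
open Summit.CriticalPhenomena.CardyFormulaZ2.Cruxes.ParafermionToSLESixFamilies.IicTraceFluxPairing (IsFamily)
open Summit.CriticalPhenomena.CardyFormulaZ2.Cruxes.EdgePrecompact.QkzStripBoundaryArm
  (cornerObs not_mem_zdBoundary_of_forall_isInnerFace)

/-! ## Interior vertices from blocks -/

/-- **Interior vertices from blocks.** At a mesh where every lattice point of the convex carrier belongs to `Ω_δ`: if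
the whole `3 × 3` block of lattice points around the vertex `v` has mesh points in the carrier, then for any data `E`
with `E.Ω = Ω`, `E.δ = δ` the vertex `v` is off both discrete arcs and every face cornered at `v` is an inner face and
a cell. -/
theorem interior_of_block {Ω : Set ℂ} (hconv : Convex ℝ Ω) {δ : ℝ}
    (hgood : ∀ x : Site 2, meshPoint δ x ∈ Ω → x ∈ meshDomain Ω δ) {E : DiscreteDobrushin} (hΩ : E.Ω = Ω)
    (hδ : E.δ = δ) {v : Site 2} (hblock : ∀ y : Site 2, (∀ i, |y i - v i| ≤ 1) → meshPoint δ y ∈ Ω) :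
    v ∉ E.zdArcA ∧ v ∉ E.zdArcB ∧ ∀ f : Site 2, IsCorner v f → E.IsInnerFace f ∧ IsCell E f := by
  have hinner : ∀ f : Site 2, IsCorner v f → E.IsInnerFace f := fun f hv =>
    isInnerFace_of_forall_corner_mem hconv hgood hΩ hδ fun w hw => hblock w (abs_sub_le_one_of_isCorner hv hw)
  have hvb : v ∉ E.zdBoundary := not_mem_zdBoundary_of_forall_isInnerFace fun k => hinner _ (isCorner_faceAt v k)
  have hA : v ∉ E.zdArcA := fun h => hvb (E.zdArcA_subset_zdBoundary h)
  have hB : v ∉ E.zdArcB := fun h => hvb (E.zdArcB_subset_zdBoundary h)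
  exact ⟨hA, hB, fun f hv => ⟨hinner f hv, hinner f hv, v, hv, hA, hB⟩⟩

/-- **Interior vertices, eventually.** Along an admissible family of a marked diamond and for a compact `K ⊆ D`: for
all small `δ`, every vertex `v` whose mesh point is within `δ` of `K` is off both discrete arcs of `Λ δ`, and every face
cornered at `v` is an inner face and a cell of `Λ δ`. -/
theorem eventually_interior_vertex (D : DobrushinDomain) (hD : IsMarkedDiamond D) (Λ : ℝ → DiscreteDobrushin)
    (hΛ : IsFamily D Λ) {K : Set ℂ} (hK : IsCompact K) (hKD : K ⊆ D.carrier) :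
    ∀ᶠ δ in 𝓝[>] (0:ℝ), ∀ v : Site 2, (∃ p ∈ K, dist (meshPoint δ v) p ≤ δ) →
      v ∉ (Λ δ).zdArcA ∧ v ∉ (Λ δ).zdArcB ∧
        ∀ f : Site 2, IsCorner v f → (Λ δ).IsInnerFace f ∧ IsCell (Λ δ) f := by
  obtain ⟨ρ, hρ, hρD⟩ := hK.exists_cthickening_subset_open D.isOpen hKD
  have hconv : Convex ℝ D.carrier := by
    obtain ⟨c, α, β, -, -, hcar⟩ := hD; rw [hcar]; exact convex_tiltedBox c _ α β
  filter_upwards [eventually_mem_meshDomain_of_isMarkedDiamond D hD,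
    Ioc_mem_nhdsGT (show 0 < ρ / 3 by positivity)] with δ hgood hδ v ⟨p, hp, hvp⟩
  have h2 : Real.sqrt 2 ≤ 2 := by nlinarith [Real.sqrt_nonneg 2, Real.sq_sqrt (show (0:ℝ) ≤ 2 by norm_num)]
  refine interior_of_block hconv hgood (hΛ.1 δ) (hΛ.2.1 δ) fun y hy => hρD ?_
  refine mem_cthickening_of_dist_le _ p ρ K hp ?_
  calc dist (meshPoint δ y) p ≤ dist (meshPoint δ y) (meshPoint δ v) + dist (meshPoint δ v) p := dist_triangle _ _ _
    _ ≤ Real.sqrt 2 * δ + δ := by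
        rw [dist_eq_norm]; exact add_le_add (norm_meshPoint_sub_le_of_block hδ.1.le hy) hvp
    _ ≤ ρ := by nlinarith [hδ.1, hδ.2]

/-- **Every face over a compact is eventually a cell.** Along an admissible family of a marked diamond, for all small
`δ` every face whose centre lies in the compact `K ⊆ D` is a cell of `Λ δ` (so the convergence clause of
`IsPotentialLimit` applies to all faces over `K`). -/
theorem eventually_isCell_of_ctr_mem : ∀ (D : DobrushinDomain), IsMarkedDiamond D → ∀ (Λ : ℝ → DiscreteDobrushin), IsFamily D Λ → ∀ {K : Set ℂ}, IsCompact K → K ⊆ D.carrier → ∀ᶠ δ in 𝓝[>] (0:ℝ), ∀ f : Site 2, ctr δ f ∈ K → IsCell (Λ δ) f := by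
  intro D hD Λ hΛ K hK hKD
  filter_upwards [eventually_interior_vertex D hD Λ hΛ hK hKD, self_mem_nhdsWithin] with δ hδ hδ0 f hf
  have h2 : Real.sqrt 2 / 2 * δ ≤ δ := by
    have : Real.sqrt 2 ≤ 2 := by nlinarith [Real.sqrt_nonneg 2, Real.sq_sqrt (show (0:ℝ) ≤ 2 by norm_num)]
    have hδ' : (0:ℝ) < δ := hδ0
    nlinarith
  exact ((hδ f ⟨ctr δ f, hf, by
    rw [dist_eq_norm]; exact (norm_corner_sub_ctr_le (le_of_lt (α := ℝ) hδ0) (isCorner_self f)).trans h2⟩).2.2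
    f (isCorner_self f)).2

/-! ## The class weights and the three faces of an exact pair at an interior vertex -/

/-- `w(0) = 1`. -/
theorem classWeight_zero : classWeight 0 = 1 := by simp [classWeight]

/-- `w(−e₀) = i`. -/
theorem classWeight_neg_e0 : classWeight (-(Pi.single 0 1 : Site 2)) = I := by
  have hne1 : (-(Pi.single 0 1 : Site 2)) ≠ 0 := by
    intro h; have := congr_fun h 0; simp at this
  simp [classWeight, hne1]

/-- `w(−e₁) = −i`. -/
theorem classWeight_neg_e1 : classWeight (-(Pi.single 1 1 : Site 2)) = -I := by
  have hne4 : (-(Pi.single 1 1 : Site 2)) ≠ 0 := by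
    intro h; have := congr_fun h 1; simp at this
  have hne5 : (-(Pi.single 1 1 : Site 2)) ≠ -(Pi.single 0 1 : Site 2) := by
    intro h; have := congr_fun h 1; simp at this
  have hne6 : (-(Pi.single 1 1 : Site 2)) ≠ -(Pi.single 0 1 : Site 2) - Pi.single 1 1 := by
    intro h; have := congr_fun h 0; simp at this
  simp [classWeight, hne4, hne5, hne6]

/-- **The three faces of an exact pair at an interior vertex.** If `v` is off both arcs and its faces `v`, `v − e₀`,
`v − e₁` (lower-left corner indexing: `NE`, `NW`, `SE`) are inner, an exact pair satisfies `Ψ(NE) = Φ v − E(v, NE)`,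
`Ψ(NW) = Φ v − i E(v, NW)`, `Ψ(SE) = Φ v + i E(v, SE)`. -/
theorem exactPair_faces {E : DiscreteDobrushin} {δ : ℝ} {Φ Ψ : Site 2 → ℂ} (hP : IsExactPair E δ Φ Ψ) {v : Site 2}
    (hA : v ∉ E.zdArcA) (hB : v ∉ E.zdArcB) (h0 : E.IsInnerFace v)
    (h1 : E.IsInnerFace (v - Pi.single 0 1)) (h3 : E.IsInnerFace (v - Pi.single 1 1)) :
    Ψ v = Φ v - cornerObs E δ v v ∧
      Ψ (v - Pi.single 0 1) = Φ v - I * cornerObs E δ v (v - Pi.single 0 1) ∧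
        Ψ (v - Pi.single 1 1) = Φ v + I * cornerObs E δ v (v - Pi.single 1 1) := by
  have c0 : IsCorner v v := isCorner_self v
  have c1 : IsCorner v (v - Pi.single 0 1) := fun i => by fin_cases i <;> simp
  have c3 : IsCorner v (v - Pi.single 1 1) := fun i => by fin_cases i <;> simp
  have e0 := hP v v c0 h0 hA hB
  have e1 := hP v _ c1 h1 hA hB
  have e3 := hP v _ c3 h3 hA hB
  rw [sub_self, classWeight_zero, one_mul] at e0
  rw [sub_sub_cancel_left, classWeight_neg_e0] at e1
  rw [sub_sub_cancel_left, classWeight_neg_e1] at e3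
  refine ⟨?_, ?_, ?_⟩
  · linear_combination (-1 : ℂ) * e0
  · linear_combination (-1 : ℂ) * e1
  · linear_combination (-1 : ℂ) * e3

end Summit.CriticalPhenomena.CardyFormulaZ2.Cruxes.ParafermionToSLESixFamilies.PotentialDarbouxPicardDiamond

end
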